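import Literature.NumberTheory.Transcendental.WeakCITCompactness
import Literature.NumberTheory.Transcendental.WeakCITTorusCoset
import HarnessLib

/-!
# Weak CIT — the discharge of `Literature.NumberTheory.Transcendental.weakCIT`

`theorem weakCIT_holds : weakCIT`: the functional ("weak") Conjecture on Intersections with Tori
(Zilber 2002, Corollary 3; Aslanyan 2024, Theorem 2.13; Kirby 2009, Theorem 4.6; also
Bombieri–Masser–Zannier 2007) — for every irreducible `V ⊆ (ℂˣ)ⁿ` there is a finite set `𝓣` of
proper subtori such that every atypical component `X` of an intersection of `V` with a coset of a
torus lies in a coset of some member of `𝓣` — proved sorry-free from the tree's proof of Ax's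
theorem (`ax_schanuel_of_field`, `RosenlichtProp4Residues.lean`).

**Proof** (Zilber 2002 / Kirby 2009: Ax–Schanuel + compactness; the compactness theorem is
replaced by an explicit ultraproduct). Suppose the conclusion fails for `V` (`dim V = d`). For each
`k` the finite family `latticeFamily n k` of saturated spans `satSpan q` of the non-zero integer
vectors `q` with `|qᵢ| ≤ k` is then not good enough: there are a torus coset `T_k = c_k · H_{Λ_k}`
and an atypical component `X_k` of `V ∩ T_k` inside no coset of a member of the family.
* `WeakCITLogPoint.lean`: `X_k` has a *logarithmic point* `L_k` — a differential field
  `(F_k; D_{k,1..n})` over `ℂ`, the generic point `y_k` of `X_k` and logarithms `x_k`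
  (`D yᵢ = yᵢ D xᵢ`), with Jacobian the identity on `S_k`, `|S_k| = dim X_k`, and constants of
  the `D`'s among Laurent monomials in `y_k` being complex numbers.
* `WeakCITTorusCoset.lean`: `Λ_k` (pure) has a basis consisting of rows `j ∈ J_k` of a unimodular
  `U_k`, and `n ≤ dim T_k + |J_k|`; since `X_k ⊆ T_k`, the new logarithms `x'_{k,j} = (U_k x_k)ⱼ`,
  `j ∈ J_k`, are constants (`y_k^{U_j}` is constant on `X_k`). Atypicality
  `d + dim T_k < dim X_k + n` gives `d < |S_k| + |J_k|`.
* `WeakCITCompactness.lean` (ultraproduct + `WeakCITSchanuel.lean` = Ax's theorem): one non-zero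
  `q ∈ ℤⁿ` such that `∏ y_{k,i}^{qᵢ}` is a constant of all `D_{k,j}` for infinitely many `k`.
* Unwinding (this file): for such `k ≥ max |qᵢ|`, every `m` in the saturated span of `q` has
  `y_k^m` constant (a derivation killing `w^a`, `a ≠ 0`, kills `w`), i.e. `Y^m` is constant on
  `X_k`, so `X_k ⊆ P₀ · H_{satSpan q}` for any `P₀ ∈ X_k` — contradicting the choice of `X_k`, as
  `satSpan q ∈ latticeFamily n k`.

## References

* B. Zilber, *Exponential sums equations and the Schanuel conjecture*, J. London Math. Soc. (2) 65
  (2002) 27–44, Thm 2 and Corollary 3.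
* J. Kirby, *The theory of the exponential differential equations of semiabelian varieties*,
  Selecta Math. 15 (2009) 445–486, Thm 4.3, Thm 4.6.
* V. Aslanyan, *The existential closedness and Zilber–Pink conjectures*, Model Theory 3 (2024)
  599–624, Theorem 2.13.
-/

noncomputable section

open MvPolynomial Set Filter

namespace Literature.NumberTheory.Transcendental

namespace WeakCIT

variable {n : ℕ}

/-! ### Binomials with a constant term -/

/-- On the torus of any field `E ⊇ ℂ`, the equation `∏ yᵢ^{mᵢ} = ν` (`m ∈ ℤⁿ`, `ν ∈ ℂ`) is the
polynomial equation `∏ Xᵢ^{mᵢ⁺} = ν ∏ Xᵢ^{mᵢ⁻}` (cf. `aeval_binomial_eq_zero_iff`). [folklore] -/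
theorem aeval_binomial_C_eq_zero_iff {E : Type*} [Field E] [Algebra ℂ E] {y : Fin n → E}
    (hy : ∀ i, y i ≠ 0) (m : Fin n → ℤ) (ν : ℂ) :
    aeval y ((∏ i, X i ^ (m i).toNat) - C ν * ∏ i, X i ^ (-m i).toNat :
      MvPolynomial (Fin n) ℂ) = 0 ↔ ∏ i, y i ^ m i = algebraMap ℂ E ν := by
  have hne : (∏ i, y i ^ (-m i).toNat) ≠ 0 :=
    Finset.prod_ne_zero_iff.mpr fun i _ => pow_ne_zero _ (hy i)
  have hprod : ∏ i, y i ^ m i = (∏ i, y i ^ (m i).toNat) / ∏ i, y i ^ (-m i).toNat := by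
    rw [← Finset.prod_div_distrib]
    refine Finset.prod_congr rfl fun i _ => ?_
    rw [← zpow_natCast, ← zpow_natCast, ← zpow_sub₀ (hy i), Int.toNat_sub_toNat_neg]
  simp only [map_sub, map_mul, map_prod, map_pow, aeval_X, aeval_C]
  rw [sub_eq_zero, hprod, div_eq_iff hne]

/-- A Laurent monomial `Y^m` constant (`= ν ∈ ℂ`) at the generic zero of `P` in an extension field
is constant (`= ν`) on every point of `Z(P)` in the torus. [folklore] -/
theorem prod_zpow_eq_of_generic {E : Type*} [Field E] [Algebra ℂ E] {y : Fin n → E}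
    (hy : ∀ i, y i ≠ 0) {P : Ideal (MvPolynomial (Fin n) ℂ)}
    (hgen : ∀ p : MvPolynomial (Fin n) ℂ, aeval y p = 0 ↔ p ∈ P) {m : Fin n → ℤ} {ν : ℂ}
    (hm : ∏ i, y i ^ m i = algebraMap ℂ E ν) {Z : Set (Fin n → ℂ)} (hZP : P ≤ vanishingIdeal ℂ Z)
    (hZU : Z ⊆ unitLocus ℂ n) {z : Fin n → ℂ} (hz : z ∈ Z) : ∏ i, z i ^ m i = ν := by
  have hmem : ((∏ i, X i ^ (m i).toNat) - C ν * ∏ i, X i ^ (-m i).toNat :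
      MvPolynomial (Fin n) ℂ) ∈ P := (hgen _).mp ((aeval_binomial_C_eq_zero_iff hy m ν).mpr hm)
  have h := (mem_vanishingIdeal_iff.mp (hZP hmem)) z hz
  rw [aeval_binomial_C_eq_zero_iff (fun i => hZU hz i) m ν, Algebra.algebraMap_self_apply] at h
  exact h

/-- A derivation killing the Laurent monomial `∏ yᵢ^{wᵢ}` of an exponential pair
(`D yᵢ = yᵢ D xᵢ`, `yᵢ ≠ 0`) kills the corresponding combination of logarithms `Σ wᵢ xᵢ`
(logarithmic derivative, `inv_mul_derivation_prod_zpow`). [folklore] -/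
theorem derivation_sum_eq_zero_of_prod {R L : Type*} [CommRing R] [Field L] [Algebra R L]
    (D : Derivation R L L) (x y : Fin n → L) (hy : ∀ i, y i ≠ 0)
    (hD : ∀ i, D (y i) = y i * D (x i)) (w : Fin n → ℤ) (hw : D (∏ i, y i ^ w i) = 0) :
    D (∑ i, (w i : L) * x i) = 0 := by
  have h := inv_mul_derivation_prod_zpow D Finset.univ y (fun i _ => hy i) w
  rw [hw, mul_zero] at h
  rw [map_sum]
  rw [h]
  refine Finset.sum_congr rfl fun i _ => ?_
  rw [Derivation.leibniz, D.map_intCast, smul_zero, add_zero, smul_eq_mul, hD i,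
    inv_mul_cancel_left₀ (hy i)]

/-! ### Saturated spans and the finite families of subtori -/

/-- The *saturated span* `{m ∈ ℤⁿ | ∃ a ≠ 0, ∃ b, a m = b q}` of an integer vector `q`: the pure
(primitive) rank-one subgroup of `ℤⁿ` through `q` (Bombieri–Gubler 3.2.6: `Λ̃ = V_Λ ∩ ℤⁿ`).
[cite: BombieriGubler2006, 3.2.6] -/
def satSpan (q : Fin n → ℤ) : AddSubgroup (Fin n → ℤ) where
  carrier := {m | ∃ a b : ℤ, a ≠ 0 ∧ a • m = b • q}
  zero_mem' := ⟨1, 0, one_ne_zero, by simp⟩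
  add_mem' := by
    rintro m m' ⟨a, b, ha, hab⟩ ⟨a', b', ha', hab'⟩
    refine ⟨a * a', a' * b + a * b', mul_ne_zero ha ha', ?_⟩
    funext i
    have h1 := congrFun hab i
    have h2 := congrFun hab' i
    simp only [Pi.add_apply, Pi.smul_apply, smul_eq_mul] at h1 h2 ⊢
    linear_combination a' * h1 + a * h2
  neg_mem' := by
    rintro m ⟨a, b, ha, hab⟩
    refine ⟨a, -b, ha, ?_⟩
    rw [smul_neg, hab, neg_smul]

/-- Membership in the saturated span. [folklore] -/
theorem mem_satSpan_iff {q m : Fin n → ℤ} : m ∈ satSpan q ↔ ∃ a b : ℤ, a ≠ 0 ∧ a • m = b • q :=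
  Iff.rfl

/-- `q` lies in its saturated span. [folklore] -/
theorem self_mem_satSpan (q : Fin n → ℤ) : q ∈ satSpan q := ⟨1, 1, one_ne_zero, rfl⟩

/-- The saturated span of a non-zero vector is non-trivial. [folklore] -/
theorem satSpan_ne_bot {q : Fin n → ℤ} (hq : q ≠ 0) : satSpan q ≠ ⊥ := fun h => by
  have := self_mem_satSpan q
  rw [h, AddSubgroup.mem_bot] at this
  exact hq this

/-- The saturated span is saturated (pure). [cite: BombieriGubler2006, 3.2.6] -/
theorem nsmulSaturated_satSpan (q : Fin n → ℤ) : (satSpan q).toAddSubmonoid.NSMulSaturated := by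
  intro k m hkm
  by_cases hk : k = 0
  · exact Or.inl hk
  · right
    obtain ⟨a, b, ha, hab⟩ := (hkm : k • m ∈ satSpan q)
    refine ⟨a * k, b, mul_ne_zero ha (Int.natCast_ne_zero.mpr hk), ?_⟩
    rw [mul_smul, natCast_zsmul, hab]

/-- A saturated subgroup containing `q` contains its saturated span. [folklore] -/
theorem satSpan_le_of_mem {Λ : AddSubgroup (Fin n → ℤ)} (hΛ : Λ.toAddSubmonoid.NSMulSaturated)
    {q : Fin n → ℤ} (hq : q ∈ Λ) : satSpan q ≤ Λ := by
  rintro m ⟨a, b, ha, hab⟩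
  have h : a • m ∈ Λ := by rw [hab]; exact Λ.zsmul_mem hq b
  rcases (AddSubgroup.saturated_iff_zsmul.mp hΛ) a m h with h' | h'
  · exact absurd h' ha
  · exact h'

/-- The finite family `{satSpan q | 0 ≠ q ∈ ℤⁿ, |qᵢ| ≤ N}` of pure rank-one lattices (i.e. of
codimension-one subtori). [folklore] -/
def latticeFamily (n N : ℕ) : Finset (AddSubgroup (Fin n → ℤ)) := by
  classical
  exact ((Fintype.piFinset fun _ : Fin n => Finset.Icc (-(N : ℤ)) N).filter fun q => q ≠ 0).image
    satSpan

/-- Members of the family are pure and non-trivial. [folklore] -/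
theorem latticeFamily_spec {N : ℕ} {Λ : AddSubgroup (Fin n → ℤ)} (h : Λ ∈ latticeFamily n N) :
    Λ.toAddSubmonoid.NSMulSaturated ∧ Λ ≠ ⊥ := by
  classical
  unfold latticeFamily at h
  obtain ⟨q, hq, rfl⟩ := Finset.mem_image.mp h
  exact ⟨nsmulSaturated_satSpan q, satSpan_ne_bot (Finset.mem_filter.mp hq).2⟩

/-- Small non-zero vectors have their saturated span in the family. [folklore] -/
theorem satSpan_mem_latticeFamily {N : ℕ} {q : Fin n → ℤ} (hq : q ≠ 0) (hN : ∀ i, (q i).natAbs ≤ N) :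
    satSpan q ∈ latticeFamily n N := by
  classical
  unfold latticeFamily
  refine Finset.mem_image.mpr ⟨q, Finset.mem_filter.mpr ⟨?_, hq⟩, rfl⟩
  rw [Fintype.mem_piFinset]
  intro i
  rw [Finset.mem_Icc, ← abs_le, ← Int.natCast_natAbs]
  exact_mod_cast hN i

/-- The dimension count: `d + dim T < dim X + n` and `n ≤ dim T + |J|` give `d < dim X + |J|`
(all dimensions but `dim T` already natural numbers; `dim T` is then finite too). [folklore] -/
theorem lt_add_of_dims {d r n j : ℕ} {h : WithBot ℕ∞} (h1 : (d : WithBot ℕ∞) + h < (r : WithBot ℕ∞) + n)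
    (h2 : (n : WithBot ℕ∞) ≤ h + j) : d < r + j := by
  induction h using WithBot.recBotCoe with
  | bot =>
    rw [WithBot.bot_add] at h2
    exact absurd (le_bot_iff.mp h2) (WithBot.natCast_ne_bot n)
  | coe a =>
    induction a using ENat.recTopCoe with
    | top =>
      exfalso
      have h1' : ((d : ℕ∞) : WithBot ℕ∞) + ((⊤ : ℕ∞) : WithBot ℕ∞) < ((r + n : ℕ) : ℕ∞) := by
        push_cast at h1 ⊢
        exact h1
      rw [← WithBot.coe_add, WithBot.coe_lt_coe, add_top] at h1'
      exact not_top_lt h1'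
    | coe m =>
      have h1' : d + m < r + n := by
        have : ((d + m : ℕ) : WithBot ℕ∞) < ((r + n : ℕ) : WithBot ℕ∞) := by push_cast at h1 ⊢; exact h1
        exact_mod_cast this
      have h2' : n ≤ m + j := by
        have : ((n : ℕ) : WithBot ℕ∞) ≤ ((m + j : ℕ) : WithBot ℕ∞) := by push_cast at h2 ⊢; exact h2
        exact_mod_cast this
      omega

end WeakCIT

open WeakCIT

/-- **Weak CIT** (functional Zilber–Pink for `𝔾ₘⁿ`: Zilber 2002, Corollary 3; Aslanyan 2024,
Theorem 2.13; Kirby 2009, Theorem 4.6) — the discharge of the named fact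
`Literature.NumberTheory.Transcendental.weakCIT`, from the tree's proof of Ax's theorem via an
ultraproduct (see the module docstring for the architecture).
[cite: Zilber2002, Corollary 3] [cite: Kirby2009, Thm 4.6] -/
theorem weakCIT_holds : weakCIT := by
  intro n V hV
  classical
  by_contra hcon
  -- Step 0: failure of the conclusion for the finite families `latticeFamily n k`
  have hk : ∀ N : ℕ, ∃ (T X : Set (Fin n → ℂ)), IsTorusCoset ℂ n T ∧ IsAtypicalComponent ℂ n V T X ∧
      ∀ Λ ∈ latticeFamily n N, ∀ c ∈ unitLocus ℂ n,
        ¬ X ⊆ (fun h => c * h) '' subgroupOfLattice ℂ Λ := by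
    intro N
    by_contra h'
    apply hcon
    refine ⟨latticeFamily n N, fun Λ hΛ => latticeFamily_spec hΛ, fun T X hT hX => ?_⟩
    by_contra h''
    apply h'
    refine ⟨T, X, hT, hX, fun Λ hΛ c hc hsub => h'' ⟨Λ, hΛ, c, hc, hsub⟩⟩
  choose T X hT hX hnot using hk
  -- Step 1: the data attached to each `k`
  choose Λ c hΛ hc hTeq using hT
  have hXirr : ∀ k, IsIrreducibleInTorus ℂ n (X k) := fun k => (hX k).1.1
  have hXsub : ∀ k, X k ⊆ V ∩ T k := fun k => (hX k).1.2.1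
  have hineq : ∀ k, zariskiDim ℂ V + zariskiDim ℂ (T k) < zariskiDim ℂ (X k) + n := fun k => (hX k).2
  have hXU : ∀ k, X k ⊆ unitLocus ℂ n := fun k => (IsIrreducibleInTorus.subset_unitLocus (hXirr k)).1
  have hL : ∀ k, ∃ L : LogPoint n, L.P = vanishingIdeal ℂ (X k) ∧
      (((L.S.card : ℕ) : ℕ∞) : WithBot ℕ∞) = zariskiDim ℂ (X k) :=
    fun k => exists_logPoint_of_isIrreducibleInTorus (hXirr k)
  choose L hLP hLS using hL
  have hUex : ∀ k, ∃ (U U' : Matrix (Fin n) (Fin n) ℤ) (J : Finset (Fin n)),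
      U * U' = 1 ∧ U' * U = 1 ∧ (∀ j ∈ J, U j ∈ Λ k) ∧
        (n : WithBot ℕ∞) ≤ zariskiDim ℂ (T k) + J.card := fun k => by
    obtain ⟨U, U', J, h1, h2, h3, h4⟩ := exists_unimodular_le_zariskiDim (hΛ k) (hc k)
    exact ⟨U, U', J, h1, h2, h3, by rw [hTeq k]; exact h4⟩
  choose U U' J hUU' hU'U hJΛ hdimT using hUex
  -- Step 2: `dim V = d` and the count `d < |S_k| + |J_k|`
  haveI hIprime : (vanishingIdeal ℂ V).IsPrime := isPrime_vanishingIdeal hV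
  haveI : Algebra.FiniteType ℂ (MvPolynomial (Fin n) ℂ ⧸ vanishingIdeal ℂ V) :=
    Algebra.FiniteType.of_surjective (Ideal.Quotient.mkₐ ℂ (vanishingIdeal ℂ V))
      Ideal.Quotient.mk_surjective
  obtain ⟨d, hd, -⟩ := Literature.RingTheory.KrullDimension.exists_ringKrullDim_eq_and_trdeg_eq ℂ
    (MvPolynomial (Fin n) ℂ ⧸ vanishingIdeal ℂ V)
  have hdV : zariskiDim ℂ V = d := hd
  have hlt : ∀ k, d < (L k).S.card + (J k).card := fun k => by
    have h1 := hineq k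
    rw [hdV, ← hLS k] at h1
    exact lt_add_of_dims h1 (hdimT k)
  -- Step 3: the new logarithms `x'_j = Σ U_{ji} xᵢ`, `j ∈ J_k`, are constants (`X_k ⊆ T_k`)
  have hrel : ∀ k, ∀ j ∈ J k, ∀ l, (L k).D l (∑ i, (U k j i : (L k).F) * (L k).x i) = 0 := by
    intro k j hj l
    set m : Fin n → ℤ := U k j with hm
    set ν : ℂ := ∏ i, c k i ^ m i with hν
    -- `Y^m = ν` on `X_k`
    have hXm : ∀ z ∈ X k, ∏ i, z i ^ m i = ν := by
      intro z hz
      have hzT : z ∈ T k := (hXsub k hz).2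
      rw [hTeq k] at hzT
      obtain ⟨h, hh, rfl⟩ := hzT
      simp only [Pi.mul_apply, mul_zpow, Finset.prod_mul_distrib, hh.2 m (hJΛ k j hj), mul_one, hν]
    -- hence at the generic point, hence killed by `D_l`
    have hbin : ((∏ i, MvPolynomial.X i ^ (m i).toNat) - C ν * ∏ i, MvPolynomial.X i ^ (-m i).toNat :
        MvPolynomial (Fin n) ℂ) ∈ (L k).P := by
      rw [hLP k, mem_vanishingIdeal_iff]
      intro z hz
      rw [aeval_binomial_C_eq_zero_iff (fun i => hXU k hz i) m ν, Algebra.algebraMap_self_apply]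
      exact hXm z hz
    have hym : ∏ i, (L k).y i ^ m i = algebraMap ℂ (L k).F ν :=
      (aeval_binomial_C_eq_zero_iff (L k).y_ne_zero m ν).mp (((L k).aeval_eq_zero_iff _).mpr hbin)
    have hD0 : (L k).D l (∏ i, (L k).y i ^ m i) = 0 := by
      rw [hym, Derivation.map_algebraMap]
    exact derivation_sum_eq_zero_of_prod ((L k).D l) (L k).x (L k).y (L k).y_ne_zero
      ((L k).map_y l) m hD0
  -- Step 4: the compactness step
  have hI : ∀ k, vanishingIdeal ℂ V ≤ (L k).P := fun k => by
    rw [hLP k]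
    exact vanishingIdeal_anti_mono ((hXsub k).trans Set.inter_subset_left)
  obtain ⟨q, hq0, hq⟩ := exists_int_relation_of_family L U U' J (vanishingIdeal ℂ V) d hd hU'U
    hI hrel hlt
  set N : ℕ := Finset.univ.sup fun i => (q i).natAbs with hN
  obtain ⟨k, hkN, hk⟩ := hq N
  -- Step 5: unwinding at this `k`: `Y^m` is constant on `X_k` for every `m ∈ satSpan q`
  obtain ⟨ν₀, hν₀⟩ := (L k).exists_eq_algebraMap q hk
  have hmono : ∀ m ∈ satSpan q, ∃ ν : ℂ, ∀ z ∈ X k, ∏ i, z i ^ m i = ν := by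
    rintro m ⟨a, b, ha, hab⟩
    set w : (L k).F := ∏ i, (L k).y i ^ m i with hw
    have hw0 : w ≠ 0 := Finset.prod_ne_zero_iff.mpr fun i _ => zpow_ne_zero _ ((L k).y_ne_zero i)
    -- `w ^ a = ν₀ ^ b` is a constant
    have hpow : ∀ (v : Fin n → ℤ) (t : ℤ),
        ∏ i, (L k).y i ^ ((t • v) i) = (∏ i, (L k).y i ^ v i) ^ t := fun v t => by
      rw [← Finset.prod_zpow]
      refine Finset.prod_congr rfl fun i _ => ?_
      rw [Pi.smul_apply, smul_eq_mul, mul_comm, zpow_mul]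
    have hwa : w ^ a = algebraMap ℂ (L k).F (ν₀ ^ b) := by
      rw [hw, ← hpow m a, hab, hpow q b, hν₀, map_zpow₀]
    have hDw : ∀ j, (L k).D j w = 0 := fun j => by
      have h := congrArg ((L k).D j) hwa
      rw [Derivation.map_algebraMap, Derivation.leibniz_zpow, zsmul_eq_mul, smul_eq_mul, mul_eq_zero,
        mul_eq_zero] at h
      rcases h with h | h | h
      · exact absurd h (Int.cast_ne_zero.mpr ha)
      · exact absurd h (zpow_ne_zero _ hw0)
      · exact h
    obtain ⟨ν, hν⟩ := (L k).exists_eq_algebraMap m hDw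
    refine ⟨ν, fun z hz => ?_⟩
    exact prod_zpow_eq_of_generic (L k).y_ne_zero (L k).aeval_eq_zero_iff hν (hLP k).le
      (hXU k) hz
  -- Step 6: hence `X_k ⊆ P₀ · H_{satSpan q}` for any `P₀ ∈ X_k` — contradiction
  obtain ⟨P₀, hP₀⟩ := (IsIrreducibleInTorus.subset_unitLocus (hXirr k)).2
  have hP₀U : P₀ ∈ unitLocus ℂ n := hXU k hP₀
  have hsub : X k ⊆ (fun h => P₀ * h) '' subgroupOfLattice ℂ (satSpan q) := by
    intro z hz
    have hzU : z ∈ unitLocus ℂ n := hXU k hz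
    refine ⟨fun i => (P₀ i)⁻¹ * z i, ⟨fun i => mul_ne_zero (inv_ne_zero (hP₀U i)) (hzU i),
      fun m hm => ?_⟩, ?_⟩
    · obtain ⟨ν, hν⟩ := hmono m hm
      have hν0 : ν ≠ 0 := by
        rw [← hν P₀ hP₀]
        exact Finset.prod_ne_zero_iff.mpr fun i _ => zpow_ne_zero _ (hP₀U i)
      simp only [mul_zpow, inv_zpow', Finset.prod_mul_distrib]
      rw [hν z hz]
      have : ∏ i, P₀ i ^ (-m i) = (∏ i, P₀ i ^ m i)⁻¹ := by
        rw [← Finset.prod_inv_distrib]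
        exact Finset.prod_congr rfl fun i _ => zpow_neg _ _
      rw [this, hν P₀ hP₀, inv_mul_cancel₀ hν0]
    · funext i
      simp only [Pi.mul_apply]
      rw [mul_inv_cancel_left₀ (hP₀U i)]
  have hqN : ∀ i, (q i).natAbs ≤ k := fun i =>
    (Finset.le_sup (f := fun i => (q i).natAbs) (Finset.mem_univ i)).trans hkN
  exact hnot k (satSpan q) (satSpan_mem_latticeFamily hq0 hqN) P₀ hP₀U hsub

end Literature.NumberTheory.Transcendental
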